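import Mathlib.Analysis.Calculus.Deriv.MeanValue
import Mathlib.Analysis.Calculus.ContDiff.Defs
import Mathlib.Analysis.Normed.Module.FiniteDimension
import Mathlib.LinearAlgebra.Matrix.Determinant.Basic
import Mathlib.Topology.Connected.Basic
import Mathlib.Topology.Order.IntermediateValue
import Mathlib.Data.Set.Card
import HarnessLib

/-!
# Wilkie 1989, §5: counting points on space curves (Lemma 5, proved; the notation of Lemmas 4 and 6)

Trunk `TranscendEllArithS`, family `periods` (periods.S28): towards the leaf
`Literature.ModelTheory.ExponentialFields.Wilkie1989_expAlgebraicPoints_mem` (`Wilkie1989.lean`; §§5–6 of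
A. J. Wilkie, *On the theory of the real exponential field*, Illinois J. Math. 33 (1989)) of the
decomposition of the named fact `Literature.ModelTheory.ExponentialFields.wilkie_isModelComplete`.
§5 ("More results for transfer", pp. 399–403) opens: "To prove Theorem 2 it only remains to show
(by Corollary 1) that if `k, K` satisfy the hypotheses of that theorem then every e.a. point of
`K` (for all `n ∈ ℕ`) lies in `kⁿ`. To do this we require generalizations of the intermediate value
theorem and some results on functions defined on space curves."  These are three statements of
real analysis (no model theory), vendored here in the case `K = ℝ` in which they are printed:

* **Lemma 5** (p. 400; **proved**, `Literature.ModelTheory.ExponentialFields.Wilkie1989_lemma5`):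
  for `f₁, …, fᵣ : [a, b] → ℝ` with continuous non-vanishing derivatives, the number of `i` such
  that `fᵢ` has a zero in `[a, b]` is `r - |S(+,+,a)| - |S(-,-,a)| - |S(+,-,b)| - |S(-,+,b)|`,
  where `S(σ, τ, x) = {i : fᵢ(x) is σ-ve and fᵢ'(x) is τ-ve}` (each `fᵢ` is strictly monotone;
  intermediate value theorem; the five sets partition `{1, …, r}`).  Stated additively
  (`|Z| + |S(+,+,a)| + ⋯ = r`) to avoid truncated subtraction.
* **Lemma 4** (p. 399; to be proved in a sequel file, statement fixed below): for a
  curve `V = V(g₁, …, gₙ₋₁) ⊆ ℝⁿ` (`gᵢ` of class `C¹`) with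
  `det ∂(g₁, …, gₙ₋₁)/∂(x₂, …, xₙ) ≠ 0` on `V` and finitely many connected components, if the fibre
  of `V` over `x₁ = β₁` inside the box `U_B` equals the fibre inside `Ū_{B+1}` and has exactly
  `r ≥ 1` points, then on a whole interval `[c, d] ∋ β₁` the fibres have exactly `r` points, at the
  endpoints some point of `V` has sup-norm `B` or `B + 1`, and over the interior every point of `V`
  has sup-norm `< B` or `> B + 1`.
* **Lemma 6** (p. 401; to be proved in a sequel file, statement fixed below): in that
  situation, for `g` of class `C¹` with `g* ≠ 0` on `V` (`g*` the derivative of `g` along `V`,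
  a quotient of two Jacobian determinants), the number of zeros of `g` on `V ∩ ([c, d] × Ū_B)` is
  `r - |S(c)(+,+)| - |S(c)(-,-)| - |S(d)(+,-)| - |S(d)(-,+)|` ("The importance of the formula …
  will be that it makes no reference to any parameterization of the variety `V`", p. 402).

This file proves Lemma 5 and sets up the notation of Lemmas 4 and 6 (`SpaceCurve.zeroLocus`,
`tailJacobian`, `fullJacobian`, `gStar`, `box`, `fibre`; the sup norm `‖x̄‖ = max |xᵢ|`,
`SpaceCurve.norm_eq_sup'_abs`).  Lemmas 4 and 6 themselves (real analysis: following the `r`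
points of the fibres along `x₁` by the implicit function theorem) are NOT here; in this notation
they read (with `V = zeroLocus g`, `g : Fin m → (Fin (m + 1) → ℝ) → ℝ` of class `C¹`, `1 ≤ m`,
`det (tailJacobian g x) ≠ 0` on `V`):

* Lemma 4: if `{connectedComponentIn V x : x ∈ V}` is finite, `0 < B`, `|β₁| < B`, `1 ≤ r`,
  `fibre V β₁ (box B) = fibre V β₁ (closure (box (B + 1)))` has `encard = r`, then there are
  `c d` with `-B ≤ c < β₁ < d ≤ B`, `(fibre V a (closure (box B))).encard = r` for all
  `a ∈ [c, d]`, for `a ∈ {c, d}` some `x ∈ V` with `x 0 = a` has `‖x‖ ∈ {B, B + 1}`, and for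
  `a ∈ (c, d)` every `x ∈ V` with `x 0 = a` has `‖x‖ < B ∨ B + 1 < ‖x‖`.
* Lemma 6: if `0 < B`, `-B ≤ c < d ≤ B`, `1 ≤ r`, `(fibre V a (closure (box B))).encard = r` for
  `a ∈ [c, d]`, `fibre V a (box B) = fibre V a (closure (box (B + 1)))` for `a ∈ (c, d)`, `h` is
  `C¹` with `gStar g h ≠ 0` on `V`, then
  `#{x ∈ V : x 0 ∈ [c, d], tail x ∈ closure (box B), h x = 0} + #S(c)(+,+) + #S(c)(-,-) +
  #S(d)(+,-) + #S(d)(-,+) = r`, where `S(a)(σ, τ) = {x ∈ fibre V a (closure (box B)) : h x σ 0,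
  gStar g h x τ 0}`.

Lemmas 4 and 6 are used in §6 inside a model `K` of `T_exp` "using transfer" (p. 405), which is
possible "because of the following result of Khovanskii" (p. 402, the Proposition; named fact
`Literature.ModelTheory.ExponentialFields.Wilkie1989_khovanskiiProposition`, `Wilkie1989Khovanskii.lean`).

## Readings of the scanned text (recorded for the reviewer)

The only available text of the paper is a scan whose OCR does not distinguish `U_B` from its
closure `Ū_B`, nor `<` from `≤`.  Three readings are fixed here by the printed proofs:
* In the conclusion of Lemma 4 and in Lemma 6 the fibres "`V ∩ ({α} × U_B)` contains exactly `r`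
  points" are read with the **closed** box `Ū_B`: the proof of Lemma 4 (p. 400) takes `d = B` when
  `d' ≥ B`, and otherwise `d = d'` where some `|φᵢ(d')| = B`, so at `α = d` one of the `r` points
  lies on the boundary of `U_B`; with the open box the statement fails already for the line
  `V = {x₂ = x₁} ⊆ ℝ²`, `B = 1`, `β₁ = 0`, `r = 1` (no admissible `d` exists).
* Accordingly `-B ≤ c < β₁ < d ≤ B` (the proof sets `d = B` in the first case).
* In Lemma 6, `g*(x̄) = ∂(g, g₁, …, gₙ₋₁)/∂(x₁, …, xₙ) · (∂(g₁, …, gₙ₋₁)/∂(x₂, …, xₙ))⁻¹` with the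
  row of `g` placed **first**: this is the order for which "`fᵢ'(t) = g*(t, φ⁽²⁾ᵢ(t), …)`"
  (proof of Lemma 6, p. 402) holds; with the row of `g` last the two sides differ by the sign
  `(-1)ⁿ⁻¹` (move the first column and the last row), and the counting formula needs the sign.

## Mathlib search

Mathlib has the intermediate value theorem on intervals (`intermediate_value_Icc`,
`intermediate_value_uIcc`), strict monotonicity from the sign of the derivative
(`strictMonoOn_of_deriv_pos`, `strictAntiOn_of_deriv_neg`), `connectedComponentIn`,
`Set.encard`, `fderiv`, `Matrix.det`; nothing on curves defined by equations.

## References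

* A. J. Wilkie, *On the theory of the real exponential field*, Illinois J. Math. 33 (1989),
  384–408: §5, Lemma 4 (pp. 399–400), Lemma 5 (pp. 400–401), Lemma 6 (pp. 401–402).
-/

noncomputable section

open Set

namespace Literature.ModelTheory.ExponentialFields

/-! ### Lemma 5: counting zeros of monotone functions by endpoint signs -/

open scoped Classical in
/-- **Wilkie 1989, Lemma 5** (p. 400), proved.  "Suppose that `r ∈ ℕ`, `r ≥ 1`, and
`f₁, …, fᵣ : [a, b] → ℝ` (`a, b ∈ ℝ`, `a < b`) have continuous non-vanishing derivatives throughout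
`[a, b]`. For `σ, τ ∈ {+, -}` and `x ∈ [a, b]` define
`S(σ, τ, x) = {i : 1 ≤ i ≤ r, fᵢ(x) is σ've and fᵢ'(x) is τ've}`. Let
`Z = {i : 1 ≤ i ≤ r, fᵢ has a zero in [a, b]}`. Then
`|Z| = r - |S(+,+,a)| - |S(-,-,a)| - |S(+,-,b)| - |S(-,+,b)|`."  Here the derivative of `fᵢ` is a
function `fᵢ'` with `HasDerivWithinAt (fᵢ) (fᵢ' x) [a, b] x` at every `x ∈ [a, b]` (one-sided at
the endpoints), continuous and non-vanishing on `[a, b]`; the identity is stated additively.  (The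
hypothesis `r ≥ 1` is not needed.) [cite: Wilkie1989, Lemma 5] -/
theorem Wilkie1989_lemma5 {r : ℕ} {a b : ℝ} (hab : a < b) (f f' : Fin r → ℝ → ℝ)
    (hf : ∀ i, ∀ x ∈ Icc a b, HasDerivWithinAt (f i) (f' i x) (Icc a b) x)
    (hf'c : ∀ i, ContinuousOn (f' i) (Icc a b)) (hf'0 : ∀ i, ∀ x ∈ Icc a b, f' i x ≠ 0) :
    (Finset.univ.filter fun i => ∃ x ∈ Icc a b, f i x = 0).card +
      (Finset.univ.filter fun i => 0 < f i a ∧ 0 < f' i a).card +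
      (Finset.univ.filter fun i => f i a < 0 ∧ f' i a < 0).card +
      (Finset.univ.filter fun i => 0 < f i b ∧ f' i b < 0).card +
      (Finset.univ.filter fun i => f i b < 0 ∧ 0 < f' i b).card = r := by
  have ha : a ∈ Icc a b := left_mem_Icc.2 hab.le
  have hb : b ∈ Icc a b := right_mem_Icc.2 hab.le
  rw [Finset.card_filter, Finset.card_filter, Finset.card_filter, Finset.card_filter,
    Finset.card_filter, ← Finset.sum_add_distrib, ← Finset.sum_add_distrib,
    ← Finset.sum_add_distrib, ← Finset.sum_add_distrib]
  refine (Finset.sum_congr rfl (g := fun _ => (1 : ℕ)) fun i _ => ?_).trans (by simp)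
  -- one function `fᵢ` at a time: it lies in exactly one of the five sets
  have hcont : ContinuousOn (f i) (Icc a b) := fun x hx => (hf i x hx).continuousWithinAt
  -- the derivative has constant sign on `[a, b]` (intermediate value theorem for `fᵢ'`)
  have hnoZero : ∀ x ∈ Icc a b, (0 : ℝ) ∉ f' i '' uIcc a x := by
    rintro x hx ⟨y, hy, hy0⟩
    exact hf'0 i y (uIcc_subset_Icc ha hx hy) hy0
  have hsign : (∀ x ∈ Icc a b, 0 < f' i x) ∨ (∀ x ∈ Icc a b, f' i x < 0) := by
    rcases lt_or_gt_of_ne (hf'0 i a ha) with hneg | hpos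
    · refine Or.inr fun x hx => ?_
      by_contra hx0
      rw [not_lt] at hx0
      refine hnoZero x hx (intermediate_value_uIcc ((hf'c i).mono (uIcc_subset_Icc ha hx)) ?_)
      exact mem_uIcc.2 (Or.inl ⟨hneg.le, hx0⟩)
    · refine Or.inl fun x hx => ?_
      by_contra hx0
      rw [not_lt] at hx0
      refine hnoZero x hx (intermediate_value_uIcc ((hf'c i).mono (uIcc_subset_Icc ha hx)) ?_)
      exact mem_uIcc.2 (Or.inr ⟨hx0, hpos.le⟩)
  have hderiv : ∀ x ∈ interior (Icc a b), deriv (f i) x = f' i x := by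
    intro x hx
    rw [interior_Icc] at hx
    exact ((hf i x (Ioo_subset_Icc_self hx)).hasDerivAt (Icc_mem_nhds hx.1 hx.2)).deriv
  rcases hsign with hpos | hneg
  · -- `fᵢ` strictly increasing
    have hmono : StrictMonoOn (f i) (Icc a b) :=
      strictMonoOn_of_deriv_pos (convex_Icc a b) hcont fun x hx => by
        rw [hderiv x hx]; exact hpos x (interior_subset hx)
    have h1 := hpos a ha
    have h2 := hpos b hb
    have hlt : f i a < f i b := hmono ha hb hab
    have hzero : (∃ x ∈ Icc a b, f i x = 0) ↔ f i a ≤ 0 ∧ 0 ≤ f i b := by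
      constructor
      · rintro ⟨x, hx, hx0⟩
        exact ⟨hx0 ▸ hmono.monotoneOn ha hx hx.1, hx0 ▸ hmono.monotoneOn hx hb hx.2⟩
      · rintro ⟨hle, hge⟩
        obtain ⟨x, hx, hx0⟩ := intermediate_value_Icc hab.le hcont ⟨hle, hge⟩
        exact ⟨x, hx, hx0⟩
    have e3 : ¬ (f i a < 0 ∧ f' i a < 0) := fun h => (not_lt.2 h1.le) h.2
    have e4 : ¬ (0 < f i b ∧ f' i b < 0) := fun h => (not_lt.2 h2.le) h.2
    rw [if_neg e3, if_neg e4]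
    by_cases hP : 0 < f i a
    · have hQ : ¬ f i b < 0 := not_lt.2 (hP.trans hlt).le
      rw [if_neg (fun h => (not_le.2 hP) (hzero.1 h).1), if_pos ⟨hP, h1⟩, if_neg (fun h => hQ h.1)]
    · by_cases hQ : f i b < 0
      · rw [if_neg (fun h => (not_le.2 hQ) (hzero.1 h).2), if_neg (fun h => hP h.1),
          if_pos ⟨hQ, h2⟩]
      · rw [if_pos (hzero.2 ⟨not_lt.1 hP, not_lt.1 hQ⟩), if_neg (fun h => hP h.1),
          if_neg (fun h => hQ h.1)]
  · -- `fᵢ` strictly decreasing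
    have hanti : StrictAntiOn (f i) (Icc a b) :=
      strictAntiOn_of_deriv_neg (convex_Icc a b) hcont fun x hx => by
        rw [hderiv x hx]; exact hneg x (interior_subset hx)
    have h1 := hneg a ha
    have h2 := hneg b hb
    have hlt : f i b < f i a := hanti ha hb hab
    have hzero : (∃ x ∈ Icc a b, f i x = 0) ↔ 0 ≤ f i a ∧ f i b ≤ 0 := by
      constructor
      · rintro ⟨x, hx, hx0⟩
        exact ⟨hx0 ▸ hanti.antitoneOn ha hx hx.1, hx0 ▸ hanti.antitoneOn hx hb hx.2⟩
      · rintro ⟨hge, hle⟩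
        obtain ⟨x, hx, hx0⟩ := intermediate_value_Icc' hab.le hcont ⟨hle, hge⟩
        exact ⟨x, hx, hx0⟩
    have e2 : ¬ (0 < f i a ∧ 0 < f' i a) := fun h => (not_lt.2 h1.le) h.2
    have e5 : ¬ (f i b < 0 ∧ 0 < f' i b) := fun h => (not_lt.2 h2.le) h.2
    rw [if_neg e2, if_neg e5]
    by_cases hP : f i a < 0
    · have hQ : ¬ 0 < f i b := not_lt.2 (hlt.trans hP).le
      rw [if_neg (fun h => (not_le.2 hP) (hzero.1 h).1), if_pos ⟨hP, h1⟩, if_neg (fun h => hQ h.1)]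
    · by_cases hQ : 0 < f i b
      · rw [if_neg (fun h => (not_le.2 hQ) (hzero.1 h).2), if_neg (fun h => hP h.1),
          if_pos ⟨hQ, h2⟩]
      · rw [if_pos (hzero.2 ⟨not_lt.1 hP, not_lt.1 hQ⟩), if_neg (fun h => hP h.1),
          if_neg (fun h => hQ h.1)]

/-! ### Space curves: zero loci, Jacobians, boxes and fibres (notation of Lemmas 4 and 6) -/

namespace SpaceCurve

variable {m : ℕ}

/-- The zero locus `V = {x̄ ∈ ℝⁿ : gᵢ(x̄) = 0 for i = 1, …, n - 1}` of `n - 1 = m` functions on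
`ℝⁿ = ℝ^{m+1}` (Wilkie 1989, Lemma 4). [cite: Wilkie1989, Lemma 4] -/
def zeroLocus (g : Fin m → (Fin (m + 1) → ℝ) → ℝ) : Set (Fin (m + 1) → ℝ) :=
  {x | ∀ i, g i x = 0}

/-- Membership in the zero locus. [folklore] -/
@[simp] theorem mem_zeroLocus {g : Fin m → (Fin (m + 1) → ℝ) → ℝ} {x : Fin (m + 1) → ℝ} :
    x ∈ zeroLocus g ↔ ∀ i, g i x = 0 := Iff.rfl

/-- The Jacobian matrix `∂(g₁, …, gₙ₋₁)/∂(x₂, …, xₙ)` at `x̄` with respect to the last `n - 1`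
coordinates (Wilkie 1989, Lemma 4: its determinant is assumed nonzero on `V`).
[cite: Wilkie1989, Lemma 4] -/
def tailJacobian (g : Fin m → (Fin (m + 1) → ℝ) → ℝ) (x : Fin (m + 1) → ℝ) :
    Matrix (Fin m) (Fin m) ℝ :=
  Matrix.of fun i j => fderiv ℝ (g i) x (Pi.single j.succ 1)

/-- The full Jacobian matrix `∂(g, g₁, …, gₙ₋₁)/∂(x₁, …, xₙ)` at `x̄` of the system augmented by
`g`, the row of `g` first (see the module docstring, "Readings", for this choice of order).
[cite: Wilkie1989, Lemma 6] -/
def fullJacobian (g : Fin m → (Fin (m + 1) → ℝ) → ℝ) (h : (Fin (m + 1) → ℝ) → ℝ)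
    (x : Fin (m + 1) → ℝ) : Matrix (Fin (m + 1)) (Fin (m + 1)) ℝ :=
  Matrix.of (Fin.cons (fun j => fderiv ℝ h x (Pi.single j 1))
    (fun i j => fderiv ℝ (g i) x (Pi.single j 1)))

/-- Wilkie's `g*` (Lemma 6, p. 401): `g*(x̄) = det ∂(g, g₁, …, gₙ₋₁)/∂(x₁, …, xₙ) ·
(det ∂(g₁, …, gₙ₋₁)/∂(x₂, …, xₙ))⁻¹`, the derivative of `g` along the curve `V` parametrized by
`x₁` ("`fᵢ'(t) = g*(t, φᵢ(t))`", p. 402). [cite: Wilkie1989, Lemma 6] -/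
def gStar (g : Fin m → (Fin (m + 1) → ℝ) → ℝ) (h : (Fin (m + 1) → ℝ) → ℝ)
    (x : Fin (m + 1) → ℝ) : ℝ :=
  (fullJacobian g h x).det * ((tailJacobian g x).det)⁻¹

/-- The open box `U_a = {(α₂, …, αₙ) ∈ ℝⁿ⁻¹ : |αᵢ| < a for i = 2, …, n}` (Wilkie 1989,
Lemma 4); `Ū_a` is its closure `closure (box a)`. [cite: Wilkie1989, Lemma 4] -/
def box (a : ℝ) : Set (Fin m → ℝ) :=
  {y | ∀ i, |y i| < a}

/-- Membership in the box. [folklore] -/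
@[simp] theorem mem_box {a : ℝ} {y : Fin m → ℝ} : y ∈ box a ↔ ∀ i, |y i| < a := Iff.rfl

/-- The fibre `V ∩ ({a} × S)` of a subset `V ⊆ ℝⁿ` over `x₁ = a`, within `S ⊆ ℝⁿ⁻¹`
(Wilkie 1989, Lemma 4: `V ∩ ({β₁} × U_B)`, `V ∩ ({β₁} × Ū_{B+1})`). [cite: Wilkie1989, Lemma 4] -/
def fibre (V : Set (Fin (m + 1) → ℝ)) (a : ℝ) (S : Set (Fin m → ℝ)) : Set (Fin (m + 1) → ℝ) :=
  {x | x ∈ V ∧ x 0 = a ∧ Fin.tail x ∈ S}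

/-- Membership in a fibre. [folklore] -/
@[simp] theorem mem_fibre {V : Set (Fin (m + 1) → ℝ)} {a : ℝ} {S : Set (Fin m → ℝ)}
    {x : Fin (m + 1) → ℝ} : x ∈ fibre V a S ↔ x ∈ V ∧ x 0 = a ∧ Fin.tail x ∈ S := Iff.rfl

/-- The sup norm of `ℝⁿ`: `‖x̄‖ = max {|xᵢ| : 1 ≤ i ≤ n}` (Wilkie's `θ`, Lemma 4). [folklore] -/
theorem norm_eq_sup'_abs (x : Fin (m + 1) → ℝ) :
    ‖x‖ = Finset.univ.sup' Finset.univ_nonempty fun i => |x i| := by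
  apply le_antisymm
  · have h0 : (0 : ℝ) ≤ Finset.univ.sup' Finset.univ_nonempty fun i => |x i| :=
      Finset.le_sup'_of_le (fun i => |x i|) (Finset.mem_univ (0 : Fin (m + 1))) (abs_nonneg (x 0))
    refine (pi_norm_le_iff_of_nonneg h0).2 fun i => ?_
    rw [Real.norm_eq_abs]
    exact Finset.le_sup' (fun i => |x i|) (Finset.mem_univ i)
  · refine Finset.sup'_le _ _ fun i _ => ?_
    rw [← Real.norm_eq_abs]
    exact norm_le_pi_norm x i

end SpaceCurve

end Literature.ModelTheory.ExponentialFields
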